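import Summits.AtomisticToContinuum.BoseEinsteinCondensation.Theorems.FibreConductance.Negative.OneDimAxis
import Summits.AtomisticToContinuum.BoseEinsteinCondensation.Theorems.FibreConductance.Negative.FibreVocabulary

/-!
# Crux `FibreConductance` — the two-slab product state

`slabZ = ∫_cell g(y₀)²` with `L³/4 ≤ Z ≤ L³`; the factor `φ = g(y₀)/√Z` (`∫φ² = 1`, positive,
`C¹`, periodic); the admissible state `slabState = φ^{⊗N} : PeriodicTrialState (m+1) L`, zero-free;
`periodicGroundStateEnergy 0 (m+1) L = 0`; the energy bound
`periodicEnergy 0 slabState ≤ N · 1024π²K²/L²`; `β₀ = 0` (`integral_wave_mul_slabFactor`, odd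
harmonic of an `L/2`-periodic profile) and the fibre charge `q = L^{-3/2} e_{e₀}(x₀) φ(x₀)`.

Crux disprover file for `stmt-AtomisticToContinuum-9480` (route `BECThomsonPrinciple`, crux
`FibreConductance`); part of the chain `Profiles → OneDimAxis → (FibreVocabulary) → SlabState →
TestFunction → NearMinimiserFalse` proving `not_fibreConductanceNearMinimiser`: the exact-minimiser
hypothesis (H1) of the crux cannot be relaxed to `δ`-near-minimality for any `δ > 0`.
All [folklore] (elementary real analysis).
-/

noncomputable section

namespace Summit.AtomisticToContinuum.BoseEinsteinCondensation.Theorems.FibreConductance.Negative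

open MeasureTheory Literature.MathematicalPhysics.QuantumManyBody.BoseGas
open scoped ENNReal NNReal

/-! ### The two-slab product state -/

section Slab

open Real intervalIntegral
open Summit.AtomisticToContinuum.BoseEinsteinCondensation.Theorems.GaussianDominationCan.Negative

variable {m : ℕ} {L σ : ℝ}

/-- For `n = e₀` the phase is `e^{iθ(y₀)}`. [folklore] -/
theorem wave_e0 (L : ℝ) (y : Space) : wave L e0 y = Complex.exp (Complex.I * (ang L (y 0) : ℝ)) := by
  unfold wave ang e0
  congr 2
  rw [Fin.sum_univ_three]
  simp
  ring

/-- Real version of `integral_cell_comp_coord0`. [folklore] -/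
theorem integral_cell_comp_coord0_real (hL : 0 ≤ L) (F : ℝ → ℝ) :
    ∫ y in cell L, F (y 0) = L ^ 2 * ∫ t in Set.Ico 0 L, F t := by
  have hpre : (WithLp.toLp 2 : (Fin 3 → ℝ) → Space) ⁻¹' cell L = Set.univ.pi fun _ => Set.Ico 0 L := by
    ext y; simp [cell]
  have hmp := PiLp.volume_preserving_toLp (Fin 3)
  have hme : MeasurableEmbedding (WithLp.toLp 2 : (Fin 3 → ℝ) → Space) :=
    (MeasurableEquiv.toLp 2 (Fin 3 → ℝ)).measurableEmbedding
  rw [← hmp.setIntegral_preimage_emb hme, hpre]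
  set g : Fin 3 → ℝ → ℝ := fun c t => if c = 0 then F t else 1 with hg
  have hprod : ∀ y : Fin 3 → ℝ, F ((WithLp.toLp 2 y : Space) 0) = ∏ c, g c (y c) := by
    intro y
    rw [Fin.prod_univ_three, hg]
    simp
  simp_rw [hprod]
  rw [volume_pi, Measure.restrict_pi_pi, integral_fintype_prod_eq_prod, Fin.prod_univ_three]
  have h0 : g 0 = F := by funext t; simp [hg]
  have h1 : g 1 = fun _ => 1 := by funext t; simp [hg]
  have h2 : g 2 = fun _ => 1 := by funext t; simp [hg]
  rw [h0, h1, h2, setIntegral_const, Measure.real, Real.volume_Ico, sub_zero, ENNReal.toReal_ofReal hL,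
    smul_eq_mul, mul_one]
  ring

/-- Set integral over `[0,L)` as an interval integral. [folklore] -/
theorem setIntegral_Ico_eq_intervalIntegral (hL : 0 ≤ L) {E : Type*} [NormedAddCommGroup E]
    [NormedSpace ℝ E] (F : ℝ → E) :
    ∫ t in Set.Ico 0 L, F t = ∫ t in (0 : ℝ)..L, F t := by
  rw [integral_Ico_eq_integral_Ioc, ← intervalIntegral.integral_of_le hL]

/-- The normalising integral `Z = ∫_cell g(y₀)² dy`. [folklore] -/
def slabZ (L σ : ℝ) : ℝ := ∫ y in cell L, slabProfile L σ (y 0) ^ 2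

/-- `Z = L² ∫₀ᴸ g²`. [folklore] -/
theorem slabZ_eq (hL : 0 ≤ L) (σ : ℝ) :
    slabZ L σ = L ^ 2 * ∫ t in (0 : ℝ)..L, slabProfile L σ t ^ 2 := by
  unfold slabZ
  rw [integral_cell_comp_coord0_real hL (fun t => slabProfile L σ t ^ 2),
    setIntegral_Ico_eq_intervalIntegral hL]

/-- **`L³/4 ≤ Z ≤ L³`.** [folklore] -/
theorem slabZ_bounds (hL : 0 < L) (hσ0 : 0 ≤ σ) (hσ1 : σ ≤ 1) :
    L ^ 3 / 4 ≤ slabZ L σ ∧ slabZ L σ ≤ L ^ 3 := by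
  rw [slabZ_eq hL.le]
  have hc : Continuous fun t => slabProfile L σ t ^ 2 := (contDiff_slabProfile L σ).continuous.pow 2
  have hi : ∀ a b : ℝ, IntervalIntegrable (fun t => slabProfile L σ t ^ 2) volume a b :=
    fun a b => hc.intervalIntegrable a b
  have hsq1 : ∀ t, slabProfile L σ t ^ 2 ≤ 1 := fun t => by
    have h := slabProfile_mem hσ1 L t
    have h0 : 0 ≤ slabProfile L σ t := hσ0.trans h.1
    nlinarith
  have hsq0 : ∀ t, 0 ≤ slabProfile L σ t ^ 2 := fun t => sq_nonneg _
  constructor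
  · have h1 : (L / 8 - 0) * 0 ≤ ∫ t in (0 : ℝ)..(L / 8), slabProfile L σ t ^ 2 := by
      have := integral_mono_on (a := 0) (b := L / 8) (by linarith) (intervalIntegrable_const (c := 0))
        (hi _ _) (fun t _ => hsq0 t)
      rwa [intervalIntegral.integral_const, smul_eq_mul] at this
    have h2 : (3 * L / 8 - L / 8) * 1 ≤ ∫ t in (L / 8)..(3 * L / 8), slabProfile L σ t ^ 2 := by
      have := integral_mono_on (a := L / 8) (b := 3 * L / 8) (by linarith)
        (intervalIntegrable_const (c := 1)) (hi _ _)
        (fun t ht => by rw [slabProfile_eq_one hL ht, one_pow])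
      rwa [intervalIntegral.integral_const, smul_eq_mul] at this
    have h3 : (L - 3 * L / 8) * 0 ≤ ∫ t in (3 * L / 8)..L, slabProfile L σ t ^ 2 := by
      have := integral_mono_on (a := 3 * L / 8) (b := L) (by linarith)
        (intervalIntegrable_const (c := 0)) (hi _ _) (fun t _ => hsq0 t)
      rwa [intervalIntegral.integral_const, smul_eq_mul] at this
    rw [← integral_add_adjacent_intervals (hi 0 (L / 8)) (hi (L / 8) L),
      ← integral_add_adjacent_intervals (hi (L / 8) (3 * L / 8)) (hi (3 * L / 8) L)]
    have hL2 : 0 < L ^ 2 := by positivity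
    nlinarith
  · have h1 : ∫ t in (0 : ℝ)..L, slabProfile L σ t ^ 2 ≤ (L - 0) * 1 := by
      have := integral_mono_on (a := 0) (b := L) hL.le (hi _ _) (intervalIntegrable_const (c := 1))
        (fun t _ => hsq1 t)
      rwa [intervalIntegral.integral_const, smul_eq_mul] at this
    have hL2 : 0 < L ^ 2 := by positivity
    nlinarith

/-- `Z > 0`. [folklore] -/
theorem slabZ_pos (hL : 0 < L) (hσ0 : 0 ≤ σ) (hσ1 : σ ≤ 1) : 0 < slabZ L σ :=
  lt_of_lt_of_le (by positivity) (slabZ_bounds hL hσ0 hσ1).1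

/-- The normalised one-dimensional profile `G = g/√Z`. [folklore] -/
def slabG (L σ t : ℝ) : ℝ := slabProfile L σ t / Real.sqrt (slabZ L σ)

/-- The one-body factor `φ(y) = g(y₀)/√Z` of the slab state. [folklore] -/
def slabFactor (L σ : ℝ) (y : Space) : ℝ := slabG L σ (y 0)

/-- `φ > 0`. [folklore] -/
theorem slabFactor_pos (hL : 0 < L) (hσ0 : 0 < σ) (hσ1 : σ ≤ 1) (y : Space) : 0 < slabFactor L σ y :=
  div_pos (slabProfile_pos hσ0 hσ1 L _) (Real.sqrt_pos.2 (slabZ_pos hL hσ0.le hσ1))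

/-- `G` is `C¹`. [folklore] -/
theorem contDiff_slabG (L σ : ℝ) : ContDiff ℝ 1 (slabG L σ) :=
  (contDiff_slabProfile L σ).div_const _

/-- `φ` is continuous. [folklore] -/
theorem continuous_slabFactor (L σ : ℝ) : Continuous (slabFactor L σ) :=
  (contDiff_slabG L σ).continuous.comp coord0.continuous

/-- `G` is `L`-periodic. [folklore] -/
theorem slabG_add_period (hL : L ≠ 0) (t : ℝ) : slabG L σ (t + L) = slabG L σ t := by
  unfold slabG; rw [slabProfile_add_period hL]

/-- `G` is `L/2`-periodic. [folklore] -/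
theorem slabG_add_half (hL : L ≠ 0) (t : ℝ) : slabG L σ (t + L / 2) = slabG L σ t := by
  unfold slabG; rw [slabProfile_add_half hL]

/-- The slab factor, lifted to `ℂ`, is the axis function of `G`. [folklore] -/
theorem slabFactor_coe (L σ : ℝ) :
    (fun y : Space => ((slabFactor L σ y : ℝ) : ℂ)) = axisFun (slabG L σ) := rfl

/-- `∫_cell φ² = 1`. [folklore] -/
theorem integral_sq_slabFactor (hL : 0 < L) (hσ0 : 0 ≤ σ) (hσ1 : σ ≤ 1) :
    ∫ y in cell L, slabFactor L σ y ^ 2 = 1 := by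
  have hZ := slabZ_pos hL hσ0 hσ1
  unfold slabFactor slabG
  simp_rw [div_pow, Real.sq_sqrt hZ.le]
  rw [MeasureTheory.integral_div]
  exact div_self hZ.ne'

/-- `∫⁻_cell ‖φ‖₊² = 1`. [folklore] -/
theorem lintegral_nnnorm_sq_slabFactor (hL : 0 < L) (hσ0 : 0 ≤ σ) (hσ1 : σ ≤ 1) :
    ∫⁻ y in cell L, ((‖((slabFactor L σ y : ℝ) : ℂ)‖₊ : ℝ≥0∞) ^ 2) = 1 := by
  simp_rw [coe_nnnorm_sq_eq_ofReal, Complex.norm_real, Real.norm_eq_abs, sq_abs]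
  rw [← ofReal_integral_eq_lintegral_ofReal
      (integrableOn_cell (f := fun y : Space => slabFactor L σ y ^ 2) ((continuous_slabFactor L σ).pow 2))
      (Filter.Eventually.of_forall fun y => sq_nonneg _),
    integral_sq_slabFactor hL hσ0 hσ1, ENNReal.ofReal_one]

/-- `∫⁻_cell ofReal φ² = 1`. [folklore] -/
theorem lintegral_ofReal_sq_slabFactor (hL : 0 < L) (hσ0 : 0 ≤ σ) (hσ1 : σ ≤ 1) :
    ∫⁻ y in cell L, ENNReal.ofReal (slabFactor L σ y ^ 2) = 1 := by
  rw [← ofReal_integral_eq_lintegral_ofReal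
      (integrableOn_cell (f := fun y : Space => slabFactor L σ y ^ 2) ((continuous_slabFactor L σ).pow 2))
      (Filter.Eventually.of_forall fun y => sq_nonneg _),
    integral_sq_slabFactor hL hσ0 hσ1, ENNReal.ofReal_one]

/-- `∫_cell φ² = 1` (complex form). [folklore] -/
theorem integral_sq_slabFactor_complex (hL : 0 < L) (hσ0 : 0 ≤ σ) (hσ1 : σ ≤ 1) :
    ∫ y in cell L, (((slabFactor L σ y ^ 2 : ℝ)) : ℂ) = 1 := by
  rw [integral_complex_ofReal, integral_sq_slabFactor hL hσ0 hσ1, Complex.ofReal_one]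

/-- **The slab state** `Φ = φ^{⊗N}`, an admissible periodic Bose trial state. [folklore] -/
def slabState (m : ℕ) (hL : 0 < L) (hσ0 : 0 < σ) (hσ1 : σ ≤ 1) : PeriodicTrialState (m + 1) L where
  ψ := realProd m (slabFactor L σ)
  contDiff := contDiff_prodFun fun _ => by
    rw [slabFactor_coe]; exact contDiff_axisFun (contDiff_slabG L σ)
  periodic X i k := prodFun_periodic (fun _ y k =>
    axisFun_periodic (G := slabG L σ) (slabG_add_period hL.ne') y k) X i k
  symm σ' X := prodFun_const_symm _ σ' X
  norm_eq := by
    show ∫⁻ X in cellN (m + 1) L,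
      (‖prodFun (fun _ : Fin (m + 1) => fun y => ((slabFactor L σ y : ℝ) : ℂ)) X‖₊ : ℝ≥0∞) ^ 2 = 1
    rw [lintegral_nnnorm_sq_prodFun (g := fun _ : Fin (m + 1) => fun y => ((slabFactor L σ y : ℝ) : ℂ))
      (fun _ => Complex.continuous_ofReal.comp (continuous_slabFactor L σ))]
    simp only [lintegral_nnnorm_sq_slabFactor hL hσ0.le hσ1, Finset.prod_const_one]

/-- Unfolding lemma for the slab state. [folklore] -/
@[simp] theorem slabState_ψ (hL : 0 < L) (hσ0 : 0 < σ) (hσ1 : σ ≤ 1) :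
    (slabState m hL hσ0 hσ1).ψ = realProd m (slabFactor L σ) := rfl

/-- The slab state has no zeros. [folklore] -/
theorem slabState_ne_zero (hL : 0 < L) (hσ0 : 0 < σ) (hσ1 : σ ≤ 1) (X : Config (m + 1)) :
    (slabState m hL hσ0 hσ1).ψ X ≠ 0 := by
  rw [slabState_ψ, ← norm_pos_iff, norm_realProd (slabFactor_pos hL hσ0 hσ1)]
  exact Finset.prod_pos fun j _ => slabFactor_pos hL hσ0 hσ1 _

/-- **The free ground-state energy vanishes** (the constant state has zero energy). [folklore] -/
theorem periodicGroundStateEnergy_zero (m : ℕ) (hL : 0 < L) :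
    periodicGroundStateEnergy 0 (m + 1) L = 0 := by
  have hc : ((Real.sqrt (L ^ 3))⁻¹) ^ 2 * L ^ 3 = 1 := by
    rw [inv_pow, Real.sq_sqrt (by positivity), inv_mul_cancel₀ (by positivity)]
  refine le_antisymm ?_ bot_le
  calc periodicGroundStateEnergy 0 (m + 1) L ≤ periodicEnergy 0 (constState m hL _ hc) :=
        periodicGroundStateEnergy_le _ _
    _ = 0 := periodicEnergy_constState hL hc

/-- **Slope of the normalised profile**: `G'² ≤ (16πK/L)² · 4/L³`. [folklore] -/
theorem deriv_slabG_sq_le (hL : 0 < L) (hσ0 : 0 ≤ σ) (hσ1 : σ ≤ 1) {K : ℝ}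
    (hK : ∀ x, |deriv smoothTransition x| ≤ K) (t : ℝ) :
    deriv (slabG L σ) t ^ 2 ≤ (16 * π * K / L) ^ 2 * (4 / L ^ 3) := by
  have hZ := slabZ_pos hL hσ0 hσ1
  have hZb := (slabZ_bounds hL hσ0 hσ1).1
  have hd : deriv (slabG L σ) t = deriv (slabProfile L σ) t / Real.sqrt (slabZ L σ) := by
    unfold slabG; rw [deriv_div_const]
  rw [hd, div_pow, Real.sq_sqrt hZ.le]
  have h1 := abs_deriv_slabProfile_le hL hσ0 hσ1 hK t
  have h2 : deriv (slabProfile L σ) t ^ 2 ≤ (16 * π * K / L) ^ 2 := by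
    rw [← sq_abs]; exact pow_le_pow_left₀ (abs_nonneg _) h1 2
  have h3 : 1 / slabZ L σ ≤ 4 / L ^ 3 := by
    rw [div_le_div_iff₀ hZ (by positivity)]; linarith
  calc deriv (slabProfile L σ) t ^ 2 / slabZ L σ = deriv (slabProfile L σ) t ^ 2 * (1 / slabZ L σ) := by ring
    _ ≤ (16 * π * K / L) ^ 2 * (4 / L ^ 3) := by gcongr

/-- **Energy of the slab state**: `E(Φ) ≤ N · 1024π²K²/L²` for the free gas. [folklore] -/
theorem periodicEnergy_slabState_le (hL : 0 < L) (hσ0 : 0 < σ) (hσ1 : σ ≤ 1) {K : ℝ}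
    (hK : ∀ x, |deriv smoothTransition x| ≤ K) :
    periodicEnergy 0 (slabState m hL hσ0 hσ1) ≤
      ENNReal.ofReal (((m + 1 : ℕ) : ℝ) * (1024 * π ^ 2 * K ^ 2 / L ^ 2)) := by
  set B : ℝ := (16 * π * K / L) ^ 2 * (4 / L ^ 3) with hB
  have hB0 : 0 ≤ B := by positivity
  set g : Fin (m + 1) → Space → ℂ := fun _ y => ((slabFactor L σ y : ℝ) : ℂ) with hg
  have hgd : ∀ i, Differentiable ℝ (g i) := fun _ => by
    rw [hg, slabFactor_coe]; exact (contDiff_axisFun (contDiff_slabG L σ)).differentiable one_ne_zero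
  have hF : Measurable fun y : Space => ((‖g 0 y‖₊ : ℝ≥0∞) ^ 2) :=
    (Complex.continuous_ofReal.comp (continuous_slabFactor L σ)).measurable.nnnorm.coe_nnreal_ennreal.pow_const _
  have hI : ∫⁻ y in cell L, ((‖g 0 y‖₊ : ℝ≥0∞) ^ 2) = 1 := lintegral_nnnorm_sq_slabFactor hL hσ0.le hσ1
  unfold periodicEnergy
  simp only [periodicInteraction_zero, zero_mul, add_zero]
  show ∫⁻ X in cellN (m + 1) L, kineticDensity (prodFun g) X ≤ _
  -- pointwise bound on the kinetic density
  have hpt : ∀ X, kineticDensity (prodFun g) X ≤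
      ∑ i : Fin (m + 1), ENNReal.ofReal B * ∏ j ∈ Finset.univ.erase i, ((‖g j (X j)‖₊ : ℝ≥0∞) ^ 2) := by
    intro X
    rw [kineticDensity_prodFun hgd]
    refine Finset.sum_le_sum fun i _ => ?_
    rw [mul_comm]
    gcongr
    rw [hg, slabFactor_coe, sum_nnnorm_sq_fderiv_axisFun ((contDiff_slabG L σ).differentiable one_ne_zero)]
    exact ENNReal.ofReal_le_ofReal (deriv_slabG_sq_le hL hσ0.le hσ1 hK _)
  have hmeas : ∀ i : Fin (m + 1), Measurable (fun X : Config (m + 1) =>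
      ENNReal.ofReal B * ∏ j ∈ Finset.univ.erase i, ((‖g j (X j)‖₊ : ℝ≥0∞) ^ 2)) := fun i =>
    measurable_const.mul (Finset.measurable_prod _ fun j _ => hF.comp (measurable_pi_apply j))
  calc ∫⁻ X in cellN (m + 1) L, kineticDensity (prodFun g) X
      ≤ ∫⁻ X in cellN (m + 1) L, ∑ i : Fin (m + 1),
          ENNReal.ofReal B * ∏ j ∈ Finset.univ.erase i, ((‖g j (X j)‖₊ : ℝ≥0∞) ^ 2) :=
        lintegral_mono hpt
    _ = ∑ i : Fin (m + 1), ∫⁻ X in cellN (m + 1) L,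
          ENNReal.ofReal B * ∏ j ∈ Finset.univ.erase i, ((‖g j (X j)‖₊ : ℝ≥0∞) ^ 2) :=
        lintegral_finsetSum _ (fun i _ => hmeas i)
    _ = ∑ _i : Fin (m + 1), ENNReal.ofReal (B * L ^ 3) := by
        refine Finset.sum_congr rfl fun i _ => ?_
        rw [lintegral_const_mul' _ _ ENNReal.ofReal_ne_top, lintegral_prod_erase i hF]
        simp only [hI, Finset.prod_const_one, mul_one]
        rw [← ENNReal.ofReal_pow hL.le, ← ENNReal.ofReal_mul hB0]
    _ = ENNReal.ofReal (((m + 1 : ℕ) : ℝ) * (1024 * π ^ 2 * K ^ 2 / L ^ 2)) := by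
        rw [Finset.sum_const, Finset.card_univ, Fintype.card_fin, nsmul_eq_mul,
          ← ENNReal.ofReal_natCast (m + 1), ← ENNReal.ofReal_mul (Nat.cast_nonneg _)]
        congr 1
        rw [hB]
        field_simp
        ring

/-- **`β₀ = 0` for the slab state**: the first harmonic of the `L/2`-periodic profile vanishes. [folklore] -/
theorem integral_wave_mul_slabFactor (hL : 0 < L) (σ : ℝ) :
    ∫ y in cell L, wave L e0 y * ((slabFactor L σ y : ℝ) : ℂ) = 0 := by
  have h : ∀ y : Space, wave L e0 y * ((slabFactor L σ y : ℝ) : ℂ) =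
      (fun t : ℝ => Complex.exp (Complex.I * (ang L t : ℝ)) * ((slabG L σ t : ℝ) : ℂ)) (y 0) := by
    intro y; rw [wave_e0]; rfl
  simp_rw [h]
  have key := integral_cell_comp_coord0 hL.le
    (fun t : ℝ => Complex.exp (Complex.I * (ang L t : ℝ)) * ((slabG L σ t : ℝ) : ℂ))
  simp only at key
  rw [key, setIntegral_Ico_eq_intervalIntegral hL.le,
    intervalIntegral_exp_ang_mul_eq_zero (G := fun t => ((slabG L σ t : ℝ) : ℂ))
      (Complex.continuous_ofReal.comp (contDiff_slabG L σ).continuous)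
      hL (fun t => by simp only [slabG_add_half hL.ne']), mul_zero]

/-- The fibre charge of the slab state: `q(X) = L^{-3/2} e_{e₀}(x₀) φ(x₀)`. [folklore] -/
theorem fibreCharge_slabState (hL : 0 < L) (hσ0 : 0 < σ) (hσ1 : σ ≤ 1) (X : Config (m + 1)) :
    fibreCharge L e0 (realProd m (slabFactor L σ)) X =
      ((Real.sqrt (L ^ 3))⁻¹ : ℂ) * (wave L e0 (X 0) * ((slabFactor L σ (X 0) : ℝ) : ℂ)) := by
  rw [fibreCharge_realProd (slabFactor_pos hL hσ0 hσ1) (integral_sq_slabFactor hL hσ0.le hσ1),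
    integral_wave_mul_slabFactor hL, zero_mul, sub_zero]

end Slab

end Summit.AtomisticToContinuum.BoseEinsteinCondensation.Theorems.FibreConductance.Negative

end
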